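import Mathlib
import Literature.RingTheory.CohomologyAnnihilator.BirationalTransfer
import Literature.RingTheory.CohomologyAnnihilator.TowerBasic
import HarnessLib

/-!
# Exponent two without the secondary obstruction (card A4, complement to `TwoStepTransfer`)

Crux `HomologicalConductor.Persistence` (stmt-ResolutionOfSingularities-16484), chain W4.4b, rung L1,
ideator 1 (technique A, pure homological algebra); plan-1 ASSIGN v0.8 row «idea-1» («LAND
`TwoStepTransfer` … exponent two at level 4», CRUX-PLAN v4 §1.3 (P-a)). The linear-map lemma
`TwoStepTransfer` itself (card A4·S1) is ALREADY in the tree: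
`Theorems/HomologicalConductorPersistenceTwoStepTransfer.lean` (`exists_comp_eq_smul_id_of_twoStep`,
`smul_ext_eq_zero_of_twoStep`, stub-3, p488064) — there `(y y')` kills `Ext^{≥1}(X, −)` PROVIDED
every linear map `P₁ → Cᵗ` extends along `ι` (the secondary obstruction vanishes). This file records
the complementary half of the card, NOT needing that hypothesis:

* `mul_smul_ext_X₃_eq_zero_of_shortExact` — dimension shifting for annihilators in the `X₃`
  direction, in any `R`-linear abelian category with `Ext`: for `0 → X₁ → X₂ → X₃ → 0` short exact,
  if `d` kills `Ext^{n₁}(X₂, N)` and `c` kills `Ext^{n₀}(X₁, N)` (`1 + n₀ = n₁`) then `c * d` kills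
  `Ext^{n₁}(X₃, N)` (exactness of `Ext^{n₀}(X₁,N) —∂→ Ext^{n₁}(X₃,N) —g^*→ Ext^{n₁}(X₂,N)`,
  Mathlib `Ext.contravariant_sequence_exact₃`). Companion of the tree's
  `mul_smul_ext_eq_zero_of_shortExact` (`StableAnnihilation`, the `X₁` direction).
* `mul_smul_ext_X₃_eq_zero_of_comp_eq_smul_id` — **exponent two, no secondary obstruction**: if
  `d • 𝟙 X₂` and `c • 𝟙 X₁` factor through projective objects then `c * d` kills `Extⁱ(X₃, N)` for
  every `N` and every `i ≥ 2`. So the extension hypothesis of `TwoStepTransfer` is only ever needed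
  for `Ext¹` / the level-one stable factorisation of `(y y') • 𝟙_X`.
* `mul_smul_ext_eq_zero_of_twoStep_of_two_le` — the same in the linear-map currency of
  `exists_comp_eq_smul_id_of_twoStep` (its hypotheses with `hext` replaced by injectivity of `ι`,
  conclusion for `i ≥ 2` instead of `i ≥ 1`).
* `mul_mem_cohomologyAnnihilatorOfDegree_two_of_forall_twoStep` — in `ModuleCat R`: if every
  finitely generated module is the cokernel of such a two-step presentation then `c * d ∈ ca²(R)`;
  run on `n`-th syzygies instead it reads `c * d ∈ caⁿ⁺²(R)` — the by-product (E1) of CHAIN w44b v4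
  §V4.2 (`𝔪_V² · T₁ ⊆ ca(T₁)` at the `1/3(1,1) × line` stage, where Auslander's `add`(covariants)
  presentation exists for the MCM = third syzygy modules; that presentation is NOT formalised here).

`[OURS · L1 w44b · idea-1]`; folklore homological algebra, NOT a statement of any manuscript.
AI-written; weaker than expert review.
-/

-- single-problem summit: the doubled namespace component is forced
set_option linter.dupNamespace false

namespace Summit.ResolutionOfSingularities.ResolutionOfSingularities.Theorems.HomologicalConductor.PersistenceTwoStepTransferExponentTwo

open CategoryTheory CategoryTheory.Abelian CategoryTheory.Limits
open Literature.RingTheory.CohomologyAnnihilator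

/-! ## In an `R`-linear abelian category -/

section Ext

universe w t v u

variable {R : Type t} [Ring R] {𝒞 : Type u} [Category.{v} 𝒞] [Abelian 𝒞] [Linear R 𝒞]
  [HasExt.{w} 𝒞]

/-- **Dimension shifting for annihilators, `X₃` direction.** Let `0 → X₁ → X₂ → X₃ → 0` be short
exact. If `d` kills `Ext^{n₁}(X₂, N)` and `c` kills `Ext^{n₀}(X₁, N)` with `1 + n₀ = n₁`, then `c * d`
kills `Ext^{n₁}(X₃, N)`: `g^* (d • e) = d • g^* e = 0`, so `d • e = ∂ x₁` for some
`x₁ : Ext^{n₀}(X₁, N)`, and `c • ∂ x₁ = ∂ (c • x₁) = 0`. [folklore] -/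
theorem mul_smul_ext_X₃_eq_zero_of_shortExact {S : ShortComplex 𝒞} (hS : S.ShortExact) {N : 𝒞}
    {n₀ n₁ : ℕ} (hn : 1 + n₀ = n₁) {c d : R} (hd : ∀ e : Ext S.X₂ N n₁, d • e = 0)
    (hc : ∀ e : Ext S.X₁ N n₀, c • e = 0) (e : Ext S.X₃ N n₁) : (c * d) • e = 0 := by
  have h2 : (Ext.mk₀ S.g).comp (d • e) (zero_add n₁) = 0 := by
    rw [Ext.comp_smul]
    exact hd _
  obtain ⟨x₁, hx₁⟩ := Ext.contravariant_sequence_exact₃ hS N (d • e) h2 hn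
  rw [mul_smul, ← hx₁, ← Ext.comp_smul, hc x₁, Ext.comp_zero]

/-- **Exponent two, no secondary obstruction.** Let `0 → X₁ → X₂ → X₃ → 0` be short exact. If
`d • 𝟙 X₂` factors through a projective object (`ι₀ ≫ π₀ = d • 𝟙 X₂`) and `c • 𝟙 X₁` factors through
a projective object (`ι₁ ≫ π₁ = c • 𝟙 X₁`), then `c * d` kills `Extⁱ(X₃, N)` for every object `N`
and every `i ≥ 2` (stable annihilation kills `Ext^{≥1}` of `X₂` and of `X₁`,
`smul_ext_eq_zero_of_comp_eq_smul_id`; then shift). For `i = 1` one needs the extension hypothesis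
of `exists_comp_eq_smul_id_of_twoStep`. [folklore] -/
theorem mul_smul_ext_X₃_eq_zero_of_comp_eq_smul_id {S : ShortComplex 𝒞} (hS : S.ShortExact)
    {Q₀ : 𝒞} [Projective Q₀] (ι₀ : S.X₂ ⟶ Q₀) (π₀ : Q₀ ⟶ S.X₂) {d : R}
    (h₀ : ι₀ ≫ π₀ = d • 𝟙 S.X₂) {Q₁ : 𝒞} [Projective Q₁] (ι₁ : S.X₁ ⟶ Q₁) (π₁ : Q₁ ⟶ S.X₁)
    {c : R} (h₁ : ι₁ ≫ π₁ = c • 𝟙 S.X₁) {N : 𝒞} {i : ℕ} (hi : 2 ≤ i) (e : Ext S.X₃ N i) :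
    (c * d) • e = 0 := by
  obtain ⟨j, rfl⟩ : ∃ j : ℕ, i = 1 + (j + 1) := ⟨i - 2, by omega⟩
  exact mul_smul_ext_X₃_eq_zero_of_shortExact hS rfl
    (fun e' => smul_ext_eq_zero_of_comp_eq_smul_id ι₀ π₀ h₀ (by omega) e')
    (fun e' => smul_ext_eq_zero_of_comp_eq_smul_id ι₁ π₁ h₁ (by omega) e') e

end Ext

/-! ## In `ModuleCat C`: the linear-map currency of `TwoStepTransfer`, and `ca²` -/

section ModuleCat

universe u

variable {C : Type u} [CommRing C]

/-- **Two-step transfer for `Ext^{≥2}`, no extension hypothesis.** In the situation of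
`exists_comp_eq_smul_id_of_twoStep` (`Theorems/HomologicalConductorPersistenceTwoStepTransfer`) —
`0 → P₁ —ι→ P₀ —π→ X → 0` exact (here `ι` injective), `β α = y • 1_{P₀}` through `Cˢ`,
`β' α' = y' • 1_{P₁}` through `Cˢ'` — but WITHOUT the hypothesis that maps `P₁ → Cᵗ` extend along
`ι`, `y y'` kills `Extⁱ_C(X, M)` for every `C`-module `M` and every `i ≥ 2`. [folklore] -/
theorem mul_smul_ext_eq_zero_of_twoStep_of_two_le {X P₀ P₁ : Type u} [AddCommGroup X]
    [Module C X] [AddCommGroup P₀] [Module C P₀] [AddCommGroup P₁] [Module C P₁]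
    (ι : P₁ →ₗ[C] P₀) (π : P₀ →ₗ[C] X) (hι : Function.Injective ι) (hexact : Function.Exact ι π)
    (hπ : Function.Surjective π) {y y' : C} {s : ℕ} (α : P₀ →ₗ[C] (Fin s → C))
    (β : (Fin s → C) →ₗ[C] P₀) (hαβ : β ∘ₗ α = y • LinearMap.id) {s' : ℕ}
    (α' : P₁ →ₗ[C] (Fin s' → C)) (β' : (Fin s' → C) →ₗ[C] P₁)
    (hαβ' : β' ∘ₗ α' = y' • LinearMap.id) (M : ModuleCat.{u} C) {i : ℕ} (hi : 2 ≤ i)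
    (e : Ext.{u} (ModuleCat.of C X) M i) : (y * y') • e = 0 := by
  obtain ⟨w, hS⟩ := exists_shortExact_of_linearMap (Y := ModuleCat.of C P₁)
    (M := ModuleCat.of C P₀) (X := ModuleCat.of C X) ι π hι hπ hexact
  rw [mul_comm]
  exact mul_smul_ext_X₃_eq_zero_of_comp_eq_smul_id hS (Q₀ := ModuleCat.of C (Fin s → C))
    (ModuleCat.ofHom α) (ModuleCat.ofHom β) ((ModuleCat.comp_eq_smul_id_iff _ _ y).mpr hαβ)
    (Q₁ := ModuleCat.of C (Fin s' → C)) (ModuleCat.ofHom α') (ModuleCat.ofHom β')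
    ((ModuleCat.comp_eq_smul_id_iff _ _ y').mpr hαβ') hi e

/-- **Exponent two in the currency `caⁿ(C)`.** If every finitely generated `C`-module `M` sits in a
short exact sequence `0 → P₁ → P₀ → M → 0` in `ModuleCat C` such that `d • 𝟙 P₀` and `c • 𝟙 P₁`
factor through projective objects, then `c * d ∈ ca²(C)`. (Run on `n`-th syzygy modules instead of
all finitely generated modules, the same argument gives `c * d ∈ caⁿ⁺²(C)`.) [folklore] -/
theorem mul_mem_cohomologyAnnihilatorOfDegree_two_of_forall_twoStep {c d : C}
    (h : ∀ M : ModuleCat.{u} C, Module.Finite C M →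
      ∃ (P₀ P₁ : ModuleCat.{u} C) (f : P₁ ⟶ P₀) (g : P₀ ⟶ M) (w : f ≫ g = 0),
        (ShortComplex.mk f g w).ShortExact ∧
        (∃ (Q₀ : ModuleCat.{u} C) (_ : Projective Q₀) (ι₀ : P₀ ⟶ Q₀) (π₀ : Q₀ ⟶ P₀),
          ι₀ ≫ π₀ = d • 𝟙 P₀) ∧
        (∃ (Q₁ : ModuleCat.{u} C) (_ : Projective Q₁) (ι₁ : P₁ ⟶ Q₁) (π₁ : Q₁ ⟶ P₁),
          ι₁ ≫ π₁ = c • 𝟙 P₁)) :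
    c * d ∈ cohomologyAnnihilatorOfDegree C 2 := by
  rw [mem_cohomologyAnnihilatorOfDegree_iff]
  intro i hi M N hM _ e
  obtain ⟨P₀, P₁, f, g, w, hS, ⟨Q₀, _, ι₀, π₀, h₀⟩, ⟨Q₁, _, ι₁, π₁, h₁⟩⟩ := h M hM
  exact mul_smul_ext_X₃_eq_zero_of_comp_eq_smul_id hS ι₀ π₀ h₀ ι₁ π₁ h₁ hi e

end ModuleCat

end Summit.ResolutionOfSingularities.ResolutionOfSingularities.Theorems.HomologicalConductor.PersistenceTwoStepTransferExponentTwo
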